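import Summits.Ventures.HodgeRepro.Night3GSetLexBasis
import Summits.Ventures.HodgeRepro.Night3SqZeroPow
import Summits.Ventures.HodgeRepro.Night3ExtTop

/-!
# The concrete form `Q(x, y) = ∫ x ∧ y ∧ Λ` on the wedge model and the monomial Gram matrix of the lines

Blind re-derivation cell `pub-hodge-repro`, seat `night-3` (gen 5).  Imports night-3's `Night3GSetLexBasis` (gen 4:
the eigen-coordinate model `V G n = ℂ^{Fin n × G}`, `Hn G n = ⋀^n V`, the lex basis, the lines `line n σ`),
`Night3SqZeroPow` (powers of sums of square-zero elements, congruences modulo an ideal) and `Night3ExtTop`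
(commuting 2-forms, the top form, `wedgeForm`).  Namespace `HodgeRepro.Night3.GSetModel`.

THE OBJECTS (NIGHT3.md §11.1).  `G` a finite group with a complex conjugation `c` (typer's `IsComplexConj c`) and a
CM type `Φ₀` (typer's `IsCMType c Φ₀`: exactly one of each pair `{ρ, cρ}` — a system of representatives of the
places; `m := |Φ₀|`, `|G| = 2m`).  For `n` factors, in the exterior algebra `⋀^• ℂ^{Fin n × G}` of the eigen-coordinates:

* `ωc c n (i, ρ) = e_{(i,ρ)} ∧ e_{(i,cρ)}` — the `(1,1)`-monomials; they pairwise commute and square to zero,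
  and generate the COMMUTATIVE subalgebra `Ac c n` (`ExtTop.evenAdjoin`);
* `Lclass c Φ₀ a i = ∑_{ρ ∈ Φ₀} a i ρ • ωc (i, ρ)` — the `(1,1)`-class of the `i`-th factor: with `Φ₀ = T_i` and
  `a i ρ` the coefficients of the Rosati-compatible polarisation of `A_{T_i}` in eigen-coordinates this is
  literally its Kähler class (the form pairs `e_ρ` with `e_{cρ}` only); since `e_ρ ∧ e_{cρ} = −e_{cρ} ∧ e_ρ`, EVERY
  `(1,1)`-form diagonal in the eigen-coordinates has this shape for some `a`;
* `Λc c Φ₀ a = ∏_i (Lclass a i)^{m−1}` — Weil's class `Λ`, of degree `2n(m−1)`;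
* `Qc hc hΦ a : BilinForm ℂ (Hn G n)`, `Qc a x y = ∫ x ∧ y ∧ Λ` — the route's form `Q′` (LEMMA-L-P-v2.md step (2))
  on the wedge model, `∫` the `e_univ`-coordinate in the top degree `n·|G| = n + n + 2n(m−1)`.

THE THEOREM (NIGHT3.md §11.2–§11.3, **`Qc_line_line_conj_ne_zero`**): `Qc a (line n σ) (line n (cσ)) ≠ 0` whenever
`a i ρ ≠ 0` on `Φ₀` — so the field `hQ` of gen 4's `WeilModelKP` («for `N ≠ 0` every line pairs non-trivially with
some line») is a THEOREM for the concrete form, for every `n` (the witness is `τ = cσ`).  The proof is the «ideal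
trick»: modulo the ideal `J` generated by the `n` monomials `ωc (i, σ')` (`σ'` the representative of `σ`'s place),
`Λ ≡ ∏_i y_i^{m−1}` with `y_i` the sum over `Φ₀ \ {σ'}`; `line σ ∧ line (cσ)` kills `J` (a repeated vector) and
`y_i^{m−1} = (m−1)! ∏_{ρ ≠ σ'} a i ρ • ωc (i, ρ)` (`SqZero.sum_erase_pow_eq`); the surviving monomial is the wedge of
ALL `n·|G|` coordinate vectors along a bijective enumeration, whose top form is `±1` (`ExtTop`); no sign is computed.
NOT here: `Alg` (S4 IS `weilSpace M ≤ Alg M`), the cycle map, the `ℚ`-structure (`K = L = ℂ`), the hypothesis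
`hproj`.  Nothing here closes S4; nothing here says anything about the status of the Hodge conjecture for CM abelian
varieties, which is NOT proved.
-/

set_option autoImplicit false
open Finset Module Function
open scoped Pointwise IsMulCommutative
namespace HodgeRepro.Night3.GSetModel

open HodgeRepro.CMHodgeOn ExteriorAlgebra

/-! ### The monomials `ωc`, the commutative subalgebra `Ac`, the classes `Lclass` and `Λc` -/

section Objects

variable {G : Type*} [Group G] [Fintype G] [DecidableEq G] [LinearOrder G]

/-- The lex basis of `ℂ^{Fin n × G}` as a family of vectors: `eV n (toLex p) = e_p`. -/
noncomputable abbrev eV (n : ℕ) : Lex (Fin n × G) → V G n := ⇑(lexBasis (G := G) n)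

/-- The index `(i, ρ)` itself, read in the lex-ordered index set. -/
abbrev fIdx (n : ℕ) : Fin n × G → Lex (Fin n × G) := fun p => toLex p

/-- The conjugate index `(i, ρ) ↦ (i, cρ)`, read in the lex-ordered index set. -/
abbrev gIdx (c : G) (n : ℕ) : Fin n × G → Lex (Fin n × G) := fun p => toLex (p.1, c * p.2)

/-- **The `(1,1)`-monomial** `ωc c n (i, ρ) = e_{(i,ρ)} ∧ e_{(i,cρ)}` in `⋀^• ℂ^{Fin n × G}`. -/
noncomputable abbrev ωc (c : G) (n : ℕ) : Fin n × G → ExteriorAlgebra ℂ (V G n) :=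
  ExtTop.ω ℂ (eV n) (fIdx n) (gIdx c n)

omit [LinearOrder G] in
/-- `ωc (i, ρ) = ι e_{(i,ρ)} * ι e_{(i,cρ)}`. -/
theorem ωc_apply (c : G) (n : ℕ) (p : Fin n × G) :
    ωc c n p = ι ℂ (coordVecOn p) * ι ℂ (coordVecOn (p.1, c * p.2)) := by
  simp only [ωc, ExtTop.ω, eV, fIdx, gIdx, lexBasis_apply, ofLex_toLex]

/-- **The commutative subalgebra** of `⋀^• ℂ^{Fin n × G}` generated by the monomials `ωc`. -/
noncomputable abbrev Ac (c : G) (n : ℕ) : Subalgebra ℂ (ExteriorAlgebra ℂ (V G n)) :=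
  ExtTop.evenAdjoin ℂ (eV n) (fIdx n) (gIdx c n)

/-- The monomial `ωc p` as an element of `Ac`. -/
noncomputable abbrev ωc' (c : G) (n : ℕ) : Fin n × G → Ac c n := ExtTop.ω' ℂ (eV n) (fIdx n) (gIdx c n)

/-- **The `(1,1)`-class of the `i`-th factor**: `∑_{ρ ∈ Φ₀} a i ρ • e_{(i,ρ)} ∧ e_{(i,cρ)}` (the Kähler class of
`A_{T_i}` in eigen-coordinates when `Φ₀ = T_i`; every eigen-diagonal `(1,1)`-form for some `a`). -/
noncomputable def Lclass (c : G) (Φ₀ : Finset G) {n : ℕ} (a : Fin n → G → ℂ) (i : Fin n) : Ac c n :=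
  ∑ ρ ∈ Φ₀, a i ρ • ωc' c n (i, ρ)

/-- **Weil's class** `Λ = ∏_{i < n} L_i^{m−1}`, `m = |Φ₀|`, in the commutative subalgebra `Ac`. -/
noncomputable def Λc (c : G) (Φ₀ : Finset G) {n : ℕ} (a : Fin n → G → ℂ) : Ac c n :=
  ∏ i : Fin n, Lclass c Φ₀ a i ^ (Φ₀.card - 1)

omit [DecidableEq G] [LinearOrder G] in
/-- Each monomial is a 2-form: `ωc p ∈ ⋀^2`. -/
theorem ωc_mem (c : G) (n : ℕ) (p : Fin n × G) : ωc c n p ∈ ⋀[ℂ]^2 (V G n) := by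
  rw [exteriorPower, pow_two]
  exact Submodule.mul_mem_mul (LinearMap.mem_range_self _ _) (LinearMap.mem_range_self _ _)

omit [DecidableEq G] [LinearOrder G] in
/-- The `(1,1)`-class of a factor is a 2-form. -/
theorem coe_Lclass_mem (c : G) (Φ₀ : Finset G) {n : ℕ} (a : Fin n → G → ℂ) (i : Fin n) :
    (Lclass c Φ₀ a i : ExteriorAlgebra ℂ (V G n)) ∈ ⋀[ℂ]^2 (V G n) := by
  rw [Lclass, AddSubmonoidClass.coe_finsetSum]
  exact Submodule.sum_mem _ fun ρ _ => by
    rw [Subalgebra.coe_smul]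
    exact Submodule.smul_mem _ _ (ωc_mem c n (i, ρ))

omit [DecidableEq G] [LinearOrder G] in
/-- A product of elements of `Ac` of degree `d` has degree `d · (number of factors)`. -/
theorem coe_prod_mem (c : G) {n : ℕ} (s : Finset (Fin n)) (F : Fin n → Ac c n) (d : ℕ)
    (hF : ∀ i, (F i : ExteriorAlgebra ℂ (V G n)) ∈ ⋀[ℂ]^d (V G n)) :
    ((∏ i ∈ s, F i : Ac c n) : ExteriorAlgebra ℂ (V G n)) ∈ ⋀[ℂ]^(d * s.card) (V G n) := by
  classical
  induction s using Finset.induction_on with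
  | empty =>
    rw [prod_empty, Subalgebra.coe_one, card_empty, mul_zero, exteriorPower, pow_zero]
    exact Submodule.one_le.mp le_rfl
  | insert i s hi ih =>
    rw [prod_insert hi, Subalgebra.coe_mul, card_insert_of_notMem hi, mul_add, mul_one, add_comm,
      exteriorPower, pow_add]
    exact Submodule.mul_mem_mul (hF i) ih

omit [DecidableEq G] [LinearOrder G] in
/-- **Weil's class has degree `2(m−1)·n`.** -/
theorem coe_Λc_mem (c : G) (Φ₀ : Finset G) {n : ℕ} (a : Fin n → G → ℂ) :
    (Λc c Φ₀ a : ExteriorAlgebra ℂ (V G n)) ∈ ⋀[ℂ]^(2 * (Φ₀.card - 1) * n) (V G n) := by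
  have h := coe_prod_mem c (univ : Finset (Fin n)) (fun i => Lclass c Φ₀ a i ^ (Φ₀.card - 1))
    (2 * (Φ₀.card - 1)) fun i => by
      rw [Subalgebra.coe_pow, exteriorPower, pow_mul]
      exact Submodule.pow_mem_pow _ (coe_Lclass_mem c Φ₀ a i) _
  rwa [card_univ, Fintype.card_fin] at h

end Objects

/-! ### The degree count `|G| = 2|Φ₀|` and the form `Qc` -/

section Form

variable {G : Type*} [Group G] [Fintype G] [DecidableEq G] [LinearOrder G]

omit [LinearOrder G] in
/-- `|G| = 2|Φ₀|` for a CM type `Φ₀` (`G = Φ₀ ⊔ c • Φ₀`). -/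
theorem card_eq_two_mul_card {c : G} (hc : IsComplexConj c) {Φ₀ : Finset G} (hΦ : IsCMType c Φ₀) :
    Fintype.card G = 2 * Φ₀.card := by
  have h1 := Finset.card_add_card_compl Φ₀
  have h2 : Φ₀ᶜ.card = Φ₀.card := by rw [← hΦ.smul_eq_compl hc, card_smul_finset]
  omega

omit [LinearOrder G] in
/-- A CM type is non-empty (`|G| ≥ 1`). -/
theorem one_le_card {c : G} (hc : IsComplexConj c) {Φ₀ : Finset G} (hΦ : IsCMType c Φ₀) : 1 ≤ Φ₀.card := by
  have := card_eq_two_mul_card hc hΦ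
  have := Fintype.card_pos (α := G)
  omega

omit [LinearOrder G] in
/-- The degree count of the form: `|Fin n × G| = n + n + 2(m−1)n`. -/
theorem card_lex_eq {c : G} (hc : IsComplexConj c) {Φ₀ : Finset G} (hΦ : IsCMType c Φ₀) (n : ℕ) :
    Fintype.card (Lex (Fin n × G)) = n + n + 2 * (Φ₀.card - 1) * n := by
  show Fintype.card (Fin n × G) = _
  rw [Fintype.card_prod, Fintype.card_fin, card_eq_two_mul_card hc hΦ]
  obtain ⟨m, hm⟩ := Nat.exists_eq_add_of_le (one_le_card hc hΦ)
  rw [hm, Nat.add_sub_cancel_left]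
  ring

/-- **THE CONCRETE FORM** `Qc a (x, y) = ∫ x ∧ y ∧ Λ` on `Hn G n = ⋀^n ℂ^{Fin n × G}`: the route's
`Q′(x, y) = ∫_{B} x ∪ y ∪ Λ` (LEMMA-L-P-v2.md step (2)) on the wedge model, `Λ = ∏_i L_i^{m−1}` with `L_i` the
`(1,1)`-class `Lclass c Φ₀ a i` of the `i`-th factor, `∫` the `e_univ`-coordinate in the top degree. -/
noncomputable def Qc {c : G} (hc : IsComplexConj c) {Φ₀ : Finset G} (hΦ : IsCMType c Φ₀) {n : ℕ}
    (a : Fin n → G → ℂ) : LinearMap.BilinForm ℂ (Hn G n) :=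
  ExtTop.wedgeForm (lexBasis n) n (2 * (Φ₀.card - 1) * n) (Λc c Φ₀ a) (coe_Λc_mem c Φ₀ a) (card_lex_eq hc hΦ n)

/-- `Qc` unfolded: the top form of `x * y * Λ`. -/
theorem Qc_apply {c : G} (hc : IsComplexConj c) {Φ₀ : Finset G} (hΦ : IsCMType c Φ₀) {n : ℕ}
    (a : Fin n → G → ℂ) (x y : Hn G n) :
    Qc hc hΦ a x y = exteriorPower.ιMultiDual ℂ _ (lexBasis n) (ExtTop.univPC (card_lex_eq hc hΦ n))
      ⟨x * y * Λc c Φ₀ a, ExtTop.mul_mul_mem x y (coe_Λc_mem c Φ₀ a)⟩ := rfl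

end Form

/-! ### The lines as wedges; the representative of a place -/

section Lines

variable {G : Type*} [Group G] [Fintype G] [DecidableEq G] [LinearOrder G]

omit [Group G] [LinearOrder G] in
/-- The `σ`-line as a wedge of the lex basis: `line n σ = ιMulti n (eV ∘ (i ↦ toLex (i, σ)))`. -/
theorem coe_line_eq (n : ℕ) (σ : G) :
    (line n σ : ExteriorAlgebra ℂ (V G n)) = ιMulti ℂ n (eV n ∘ fun i : Fin n => toLex (i, σ)) := by
  rw [line, coordWedgeOn, exteriorPower.ιMulti_apply_coe]
  congr 1
  funext i
  simp only [Function.comp_apply, eV, lexBasis_apply, ofLex_toLex]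

/-- The representative of the place of `σ` in the CM type `Φ₀`: `σ` if `σ ∈ Φ₀`, else `cσ`. -/
def rep (c : G) (Φ₀ : Finset G) (σ : G) : G := if σ ∈ Φ₀ then σ else c * σ

omit [Fintype G] [LinearOrder G] in
/-- The representative lies in `Φ₀`. -/
theorem rep_mem {c : G} {Φ₀ : Finset G} (hΦ : IsCMType c Φ₀) (σ : G) : rep c Φ₀ σ ∈ Φ₀ := by
  unfold rep
  split_ifs with h
  · exact h
  · exact not_not.mp fun h' => h ((hΦ σ).mpr h')

omit [Fintype G] [LinearOrder G] in
/-- The representative is `σ` or `cσ`. -/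
theorem rep_eq_or (c : G) (Φ₀ : Finset G) (σ : G) : rep c Φ₀ σ = σ ∨ rep c Φ₀ σ = c * σ := by
  unfold rep
  split_ifs <;> simp

omit [Fintype G] [DecidableEq G] [LinearOrder G] in
/-- `c * (c * g) = g`. -/
theorem conj_conj {c : G} (hc : IsComplexConj c) (g : G) : c * (c * g) = g := by
  rw [← mul_assoc, hc.mul_self, one_mul]

omit [Fintype G] [DecidableEq G] [LinearOrder G] in
/-- `cσ ≠ σ`. -/
theorem conj_ne {c : G} (hc : IsComplexConj c) (σ : G) : c * σ ≠ σ := fun h =>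
  hc.ne_one (mul_right_cancel (a := c) (b := σ) (c := 1) (by rw [one_mul]; exact h))

omit [Fintype G] [LinearOrder G] in
/-- **The other places miss `σ` and `cσ`**: for `ρ ∈ Φ₀ \ {rep σ}`, neither `ρ` nor `cρ` is `σ` or `cσ`. -/
theorem mem_erase_rep_ne {c : G} (hc : IsComplexConj c) {Φ₀ : Finset G} (hΦ : IsCMType c Φ₀) {σ ρ : G}
    (hρ : ρ ∈ Φ₀.erase (rep c Φ₀ σ)) : ρ ≠ σ ∧ ρ ≠ c * σ ∧ c * ρ ≠ σ ∧ c * ρ ≠ c * σ := by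
  obtain ⟨hρ1, hρ2⟩ := mem_erase.mp hρ
  unfold rep at hρ1
  split_ifs at hρ1 with hσ
  · refine ⟨hρ1, fun h => ?_, fun h => ?_, fun h => hρ1 (mul_left_cancel h)⟩
    · exact (hΦ σ).mp hσ (h ▸ hρ2)
    · exact (hΦ σ).mp hσ (by rw [← h, conj_conj hc]; exact hρ2)
  · refine ⟨fun h => hσ (h ▸ hρ2), hρ1, fun h => ?_, fun h => hσ ?_⟩
    · exact hρ1 (by rw [← h, conj_conj hc])
    · rw [← mul_left_cancel h]; exact hρ2

end Lines

/-! ### The monomial Gram matrix: `Qc (line σ) (line (cσ)) ≠ 0` -/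

section Main

variable {G : Type*} [Group G] [Fintype G] [DecidableEq G] [LinearOrder G]
variable {c : G} {Φ₀ : Finset G} {n : ℕ}

/-- The ideal of `Ac` generated by the `n` monomials `ωc (i, rep σ)`, `i < n` — killed by `line σ ∧ line (cσ)`. -/
noncomputable abbrev Jσ (c : G) (Φ₀ : Finset G) (n : ℕ) (σ : G) : Ideal (Ac c n) :=
  Ideal.span (Set.range fun i : Fin n => ωc' c n (i, rep c Φ₀ σ))

/-- The sum of the `(1,1)`-monomials of the `i`-th factor over the OTHER places: `∑_{ρ ∈ Φ₀ \ {rep σ}} a i ρ • ωc (i, ρ)`. -/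
noncomputable def ySum (c : G) (Φ₀ : Finset G) (a : Fin n → G → ℂ) (σ : G) (i : Fin n) : Ac c n :=
  ∑ ρ ∈ Φ₀.erase (rep c Φ₀ σ), a i ρ • ωc' c n (i, ρ)

omit [DecidableEq G] [LinearOrder G] in
/-- The monomials commute with everything. -/
theorem ωc_mul_comm (p : Fin n × G) (z : ExteriorAlgebra ℂ (V G n)) : ωc c n p * z = z * ωc c n p :=
  ExtTop.two_form_comm _ _ _

omit [LinearOrder G] in
/-- **`line σ ∧ line (cσ) ∧ ωc (i, rep σ) = 0`**: the wedge repeats the vector `e_{(i, rep σ)}`. -/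
theorem line_mul_line_mul_ωc_rep (σ : G) (i : Fin n) :
    (line n σ : ExteriorAlgebra ℂ (V G n)) * line n (c * σ) * ωc c n (i, rep c Φ₀ σ) = 0 := by
  rw [coe_line_eq, coe_line_eq]
  simp only [ωc, ExtTop.ω_eq_ιMulti, ιMulti_mul_ιMulti]
  apply ιMulti_eq_zero_of_not_inj
  intro hinj
  rcases rep_eq_or c Φ₀ σ with h | h
  · have := hinj (a₁ := Fin.castAdd 2 (Fin.castAdd n i)) (a₂ := Fin.natAdd (n + n) 0)
      (by rw [Fin.append_left, Fin.append_left, Fin.append_right, Matrix.cons_val_zero, h]; rfl)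
    have hv := congrArg Fin.val this
    simp only [Fin.val_castAdd, Fin.val_natAdd, Fin.val_zero] at hv
    omega
  · have := hinj (a₁ := Fin.castAdd 2 (Fin.natAdd n i)) (a₂ := Fin.natAdd (n + n) 0)
      (by rw [Fin.append_left, Fin.append_right, Fin.append_right, Matrix.cons_val_zero, h]; rfl)
    have hv := congrArg Fin.val this
    simp only [Fin.val_castAdd, Fin.val_natAdd, Fin.val_zero] at hv
    omega

omit [LinearOrder G] in
/-- **`line σ ∧ line (cσ)` kills the ideal `Jσ`.** -/
theorem line_mul_line_mul_coe_eq_zero_of_mem (σ : G) {z : Ac c n} (hz : z ∈ Jσ c Φ₀ n σ) :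
    (line n σ : ExteriorAlgebra ℂ (V G n)) * line n (c * σ) * z = 0 := by
  obtain ⟨r, hr⟩ := Ideal.mem_span_range_iff_exists_fun.mp hz
  rw [← hr, AddSubmonoidClass.coe_finsetSum, Finset.mul_sum]
  refine Finset.sum_eq_zero fun i _ => ?_
  rw [Subalgebra.coe_mul, ExtTop.coe_ω', ← ωc_mul_comm, ← mul_assoc, line_mul_line_mul_ωc_rep, zero_mul]

omit [LinearOrder G] in
/-- `L_i = a i (rep σ) • ωc (i, rep σ) + y_i`. -/
theorem Lclass_eq_add (hΦ : IsCMType c Φ₀) (a : Fin n → G → ℂ) (σ : G) (i : Fin n) :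
    Lclass c Φ₀ a i = a i (rep c Φ₀ σ) • ωc' c n (i, rep c Φ₀ σ) + ySum c Φ₀ a σ i := by
  rw [Lclass, ySum, Finset.add_sum_erase Φ₀ (fun ρ => a i ρ • ωc' c n (i, ρ)) (rep_mem hΦ σ)]

omit [LinearOrder G] in
/-- **The ideal trick**: `Λ ≡ ∏_i y_i^{m−1} (mod Jσ)`. -/
theorem Λc_sub_mem (hΦ : IsCMType c Φ₀) (a : Fin n → G → ℂ) (σ : G) :
    Λc c Φ₀ a - ∏ i, ySum c Φ₀ a σ i ^ (Φ₀.card - 1) ∈ Jσ c Φ₀ n σ := by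
  unfold Λc
  refine SqZero.prod_sub_prod_mem _ _ _ _ fun i _ => SqZero.pow_sub_pow_mem _ ?_ _
  rw [Lclass_eq_add hΦ a σ i, add_sub_cancel_right]
  exact Submodule.smul_of_tower_mem _ _ (Ideal.subset_span ⟨i, rfl⟩)

omit [LinearOrder G] in
/-- `y_i^{m−1} = (m−1)! · (∏_{ρ ≠ rep σ} a i ρ) • ∏_{ρ ≠ rep σ} ωc (i, ρ)` (`SqZero.sum_erase_pow_eq`). -/
theorem ySum_pow (hΦ : IsCMType c Φ₀) (a : Fin n → G → ℂ) (σ : G) (i : Fin n) :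
    ySum c Φ₀ a σ i ^ (Φ₀.card - 1) =
      ((Φ₀.card - 1).factorial : ℂ) • (∏ ρ ∈ Φ₀.erase (rep c Φ₀ σ), a i ρ) •
        ∏ ρ ∈ Φ₀.erase (rep c Φ₀ σ), ωc' c n (i, ρ) := by
  rw [ySum, SqZero.sum_erase_pow_eq Φ₀ _ (rep_mem hΦ σ) _
    (fun ρ _ => by rw [smul_pow, ExtTop.ω'_sq, smul_zero]), Finset.prod_smul, ← nsmul_eq_mul,
    ← Nat.cast_smul_eq_nsmul ℂ]

omit [LinearOrder G] in
/-- `∏_i y_i^{m−1} = ((m−1)!)^n (∏_i ∏_{ρ ≠ rep σ} a i ρ) • ∏_{(i,ρ), ρ ≠ rep σ} ωc (i, ρ)`. -/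
theorem prod_ySum_pow (hΦ : IsCMType c Φ₀) (a : Fin n → G → ℂ) (σ : G) :
    ∏ i, ySum c Φ₀ a σ i ^ (Φ₀.card - 1) =
      (((Φ₀.card - 1).factorial : ℂ) ^ n * ∏ i, ∏ ρ ∈ Φ₀.erase (rep c Φ₀ σ), a i ρ) •
        ∏ p ∈ (univ : Finset (Fin n)) ×ˢ Φ₀.erase (rep c Φ₀ σ), ωc' c n p := by
  rw [Finset.prod_congr rfl fun i _ => ySum_pow hΦ a σ i, Finset.prod_smul, Finset.prod_smul, prod_const,
    card_univ, Fintype.card_fin, smul_smul, Finset.prod_product' _ _ fun i ρ => ωc' c n (i, ρ)]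

omit [LinearOrder G] in
/-- **The surviving monomial is one wedge**: `∏_{(i,ρ), ρ ≠ rep σ} ωc (i, ρ) = ιMulti (2(m−1)n) (e ∘ idx)` for an
injective enumeration `idx` of the indices `(i, ρ)`, `(i, cρ)` with `ρ ∈ Φ₀ \ {rep σ}`. -/
theorem exists_idx (hΦ : IsCMType c Φ₀) (σ : G) :
    ∃ (k : ℕ) (idx : Fin k → Lex (Fin n × G)), k = 2 * (Φ₀.card - 1) * n ∧ Injective idx ∧
      (∀ j, ∃ p ∈ (univ : Finset (Fin n)) ×ˢ Φ₀.erase (rep c Φ₀ σ),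
        idx j = toLex p ∨ idx j = toLex (p.1, c * p.2)) ∧
      ((∏ p ∈ (univ : Finset (Fin n)) ×ˢ Φ₀.erase (rep c Φ₀ σ), ωc' c n p : Ac c n) :
        ExteriorAlgebra ℂ (V G n)) = ιMulti ℂ k (eV n ∘ idx) := by
  set T : Finset (Fin n × G) := (univ : Finset (Fin n)) ×ˢ Φ₀.erase (rep c Φ₀ σ) with hT
  have hf : Set.InjOn (fIdx n) (T : Set (Fin n × G)) := fun p _ q _ h => toLex.injective h
  have hg : Set.InjOn (gIdx c n) (T : Set (Fin n × G)) := by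
    intro p _ q _ h
    obtain ⟨h1, h2⟩ := Prod.mk.inj (toLex.injective h)
    exact Prod.ext h1 (mul_left_cancel h2)
  have hfg : ∀ p ∈ T, ∀ q ∈ T, fIdx n p ≠ gIdx c n q := by
    intro p hp q hq h
    have h' : p = (q.1, c * q.2) := toLex.injective h
    have hp2 : p.2 ∈ Φ₀ := mem_of_mem_erase (mem_product.mp hp).2
    have hq2 : q.2 ∈ Φ₀ := mem_of_mem_erase (mem_product.mp hq).2
    have hpq : p.2 = c * q.2 := congrArg Prod.snd h'
    exact (hΦ q.2).mp hq2 (hpq ▸ hp2)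
  obtain ⟨k, idx, hk, hinj, hrange, hprod⟩ := ExtTop.coe_prod_ω' ℂ (eV n) (fIdx n) (gIdx c n) T hf hg hfg
  refine ⟨k, idx, ?_, hinj, hrange, hprod⟩
  have hTc : T.card = n * (Φ₀.card - 1) := by
    rw [hT, card_product, card_univ, Fintype.card_fin, card_erase_of_mem (rep_mem hΦ σ)]
  rw [hk, hTc, ← Nat.mul_assoc, Nat.mul_right_comm]

/-- **THE MONOMIAL GRAM MATRIX, diagonal entry: `Qc a (line σ) (line (cσ)) ≠ 0`** for non-vanishing coefficients
`a` — the field `hQ` of the Weil model, as a theorem, for every number `n` of factors (witness `τ = cσ`).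
`Qc (line σ) (line (cσ)) = ± ((m−1)!)^n ∏_i ∏_{ρ ≠ rep σ} a i ρ`. -/
theorem Qc_line_line_conj_ne_zero (hc : IsComplexConj c) (hΦ : IsCMType c Φ₀) (a : Fin n → G → ℂ)
    (ha : ∀ i ρ, ρ ∈ Φ₀ → a i ρ ≠ 0) (σ : G) :
    Qc hc hΦ a (line n σ) (line n (c * σ)) ≠ 0 := by
  classical
  obtain ⟨k, idx, hk, hinj, hrange, hprod⟩ := exists_idx (n := n) hΦ σ
  subst hk
  have hC0 : ((Φ₀.card - 1).factorial : ℂ) ^ n * ∏ i, ∏ ρ ∈ Φ₀.erase (rep c Φ₀ σ), a i ρ ≠ 0 :=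
    mul_ne_zero (pow_ne_zero _ (Nat.cast_ne_zero.mpr (Nat.factorial_ne_zero _)))
      (Finset.prod_ne_zero_iff.mpr fun i _ => Finset.prod_ne_zero_iff.mpr fun ρ hρ =>
        ha i ρ (mem_of_mem_erase hρ))
  -- the index family of the full wedge and its bijectivity
  set W : Fin (n + n + 2 * (Φ₀.card - 1) * n) → Lex (Fin n × G) :=
    Fin.append (Fin.append (fun i : Fin n => toLex (i, σ)) (fun i : Fin n => toLex (i, c * σ))) idx with hW
  have hWbij : Bijective W := by
    refine (Fintype.bijective_iff_injective_and_card _).mpr ⟨?_, ?_⟩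
    · refine Fin.append_injective_iff.mpr ⟨Fin.append_injective_iff.mpr ⟨?_, ?_, ?_⟩, hinj, ?_⟩
      · intro i j h
        exact congrArg (fun x => (ofLex x).1) h
      · intro i j h
        exact congrArg (fun x => (ofLex x).1) h
      · intro i j h
        exact conj_ne hc σ (congrArg (fun x => (ofLex x).2) h).symm
      · intro i j h
        obtain ⟨p, hp, hpj⟩ := hrange j
        obtain ⟨h1, h2, h3, h4⟩ := mem_erase_rep_ne hc hΦ (mem_product.mp hp).2
        cases i using Fin.addCases with
        | left i =>
          rw [Fin.append_left] at h
          rcases hpj with hpj | hpj <;> rw [hpj] at h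
          · exact h1 (congrArg (fun x => (ofLex x).2) h).symm
          · exact h3 (congrArg (fun x => (ofLex x).2) h).symm
        | right i =>
          rw [Fin.append_right] at h
          rcases hpj with hpj | hpj <;> rw [hpj] at h
          · exact h2 (congrArg (fun x => (ofLex x).2) h).symm
          · exact h4 (congrArg (fun x => (ofLex x).2) h).symm
    · rw [Fintype.card_fin, card_lex_eq hc hΦ n]
  -- the key identity: `line σ ∧ line (cσ) ∧ Λ = C • (the full wedge)`
  have key : (line n σ : ExteriorAlgebra ℂ (V G n)) * line n (c * σ) * (Λc c Φ₀ a : ExteriorAlgebra ℂ (V G n)) =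
      (((Φ₀.card - 1).factorial : ℂ) ^ n * ∏ i, ∏ ρ ∈ Φ₀.erase (rep c Φ₀ σ), a i ρ) •
        ιMulti ℂ (n + n + 2 * (Φ₀.card - 1) * n) (eV n ∘ W) := by
    have hΛ : Λc c Φ₀ a = (∏ i, ySum c Φ₀ a σ i ^ (Φ₀.card - 1)) +
        (Λc c Φ₀ a - ∏ i, ySum c Φ₀ a σ i ^ (Φ₀.card - 1)) := (add_sub_cancel _ _).symm
    rw [hΛ, Subalgebra.coe_add, mul_add, line_mul_line_mul_coe_eq_zero_of_mem σ (Λc_sub_mem hΦ a σ), add_zero,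
      prod_ySum_pow hΦ a σ, Subalgebra.coe_smul, hprod, mul_smul_comm, coe_line_eq, coe_line_eq,
      ιMulti_mul_ιMulti, ιMulti_mul_ιMulti, hW, ExtTop.comp_append, ExtTop.comp_append]
  rw [Qc_apply, ExtTop.ιMultiDual_mk_smul_ιMulti (lexBasis n) _ _ _ _ key]
  exact mul_ne_zero hC0 (ExtTop.ιMultiDual_univ_ιMulti_of_bijective_ne_zero (lexBasis n) _ W hWbij)

end Main

end HodgeRepro.Night3.GSetModel
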